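import Mathlib
import Summits.KontsevichZagierPeriods.KontsevichZagierPeriods.Theorems.InverseLandauTateFamilyKernelRationalCertificate

/-!
# Crux `TateFamilyKernel` (stmt-KontsevichZagierPeriods-9130), line `Sketch`:
# stub `stub_eulerBandExact` (wave 12, Euler sector — (C) the EXACT FACE BAND)

Step (C) of the Euler sector of the lead's skeleton of the crux
`Summit.KontsevichZagierPeriods.KontsevichZagierPeriods.Theses.InverseLandau.TateFamilyKernel`
(route `InverseLandau`). After the Euler anchor (A) and the divergence theorem on the 3-cube (B), the
fibre of the weighted-homogeneous pencil is congruent, modulo relations, to a tame cube `rb` on the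
square with coordinates `s = X 0`, `t = X 1` (the parameter `ϖ₀` sits in the slot `X 2`, evaluation
`aeval (Fin.snoc y ϖ₀)`), whose integrand is the WEIGHTED FACE BAND

  `t^{λ−1} · N(y)/(Q_a Q_b)(y)`,  `λ = w + a + b`,

`N = a·P₀(1,s)·Q_b + b·P₀(s,1)·Q_a`, `Q_a = 1 − ϖ₀ t^d T(1,s)`, `Q_b = 1 − ϖ₀ t^d T(s,1)`. This file
proves: if the unweighted face family has a RATIONAL PRIMITIVE in `s` along `ϖ = ϖ₀ t^d` — data
`Em/Ed ∈ ℚ(s, ϖ)` lifted by `bind₁ ![X 0, X 2 * X 1 ^ d]`, pole-free on the square, with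
`∂_s (Em/Ed)(s, ϖ₀t^d) = N/(Q_a Q_b)` and equal end values `(Em/Ed)(1, ·) = (Em/Ed)(0, ·)` — then
`[rb] ∈ KZ.relations`.

Proof (ONE Ayoub element in the direction `s`): with `G(y) = t^{λ−1}·(Em/Ed)(s, ϖ₀t^d)` (the slice at
`ϖ₀` of the polynomial quotient `X 1^{λ−1}·Em₃ / Ed₃`, analytic near and `ℚ`-semialgebraic on the
square because `Ed₃ ≠ 0` there) one has `∂_s G = t^{λ−1}·N/(Q_a Q_b) =` the integrand of `rb`, and
the two faces `G|_{s=1}`, `G|_{s=0}` are the SAME function of `t`; hence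
`rb`'s integrand `= ∂_s G − G|_{s=1} + G|_{s=0}` on the square, which is exactly the shape of
`tame_relA_mem_relations` (file `InverseLandauTateFamilyKernelTameRelA.lean`: the Ayoub element
`[∂ᵢG − G|₁ + G|₀]` of tame data is a relation). The abstract form, for any weight exponent `m` and
any polynomial data `A/D`, `Nn/Qd`, is `EulerBandExact.band_mem_relations`.

References: Kontsevich–Zagier 2001, §1.2 (rules (1)–(3)); Ayoub, EMS Newsl. 91 (2014), Def. 10.
Mathlib plus the landed toolkit (`analyticOnNhd_slice`, `isSemialgebraicFunOn_slice`,
`tame_relA_mem_relations`); no named fact, no new definition. Helpers live in the sub-namespace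
`EulerBandExact`.
-/

noncomputable section

open MeasureTheory Set MvPolynomial
open Literature.NumberTheory.Transcendental

namespace Summit.KontsevichZagierPeriods.InverseLandau.TateFamilyKernel.Descent

namespace EulerBandExact

/-- Updating coordinate `0` of a point `w` of the plane gives the point `(s, w 1)`. [folklore] -/
theorem update_zero_eq_vec (w : Fin 2 → ℝ) (s : ℝ) : Function.update w 0 s = ![s, w 1] := by
  funext j
  fin_cases j <;> rfl

/-- Pulling the weight `t^m = (X 1)^m` out of a polynomial quotient evaluated at `(y, ϖ₀)`:
`((X 1)^m·A / D)(y, ϖ₀) = (y 1)^m · (A/D)(y, ϖ₀)`. [folklore] -/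
theorem aeval_X_one_pow_mul_div (m : ℕ) (A D : MvPolynomial (Fin (2 + 1)) ℚ) (y : Fin 2 → ℝ)
    (ϖ₀ : ℝ) :
    aeval (Fin.snoc y ϖ₀ : Fin (2 + 1) → ℝ) (X 1 ^ m * A) / aeval (Fin.snoc y ϖ₀ : Fin (2 + 1) → ℝ) D =
      y 1 ^ m * (aeval (Fin.snoc y ϖ₀ : Fin (2 + 1) → ℝ) A / aeval (Fin.snoc y ϖ₀ : Fin (2 + 1) → ℝ) D) := by
  rw [map_mul, map_pow, aeval_X, mul_div_assoc]
  rfl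

/-- **The weighted band of an exact face family is a relation** (abstract form). Polynomial data
`A, D, Nn, Qd ∈ ℚ[s, t, ϖ]` evaluated at `ϖ = ϖ₀` real-algebraic, with `D, Qd ≠ 0` on the square,
`∂_s (A/D)(s, t, ϖ₀) = (Nn/Qd)(s, t, ϖ₀)` on the square and equal end values
`(A/D)(1, t, ϖ₀) = (A/D)(0, t, ϖ₀)` for `t ∈ [0,1]`: every tame cube representation of the weighted
band `t^m · Nn/Qd` is a relation — it is the Ayoub element in the direction `s` of the tame datum
`G = t^m · A/D` (`tame_relA_mem_relations`), whose two `s`-faces coincide.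
[cite: KontsevichZagier2001, §1.2] -/
theorem band_mem_relations (m : ℕ) {ϖ₀ : ℝ} (halg : IsAlgebraic ℚ ϖ₀)
    (A D Nn Qd : MvPolynomial (Fin (2 + 1)) ℚ)
    (hD : ∀ y ∈ KZ.cube 2, aeval (Fin.snoc y ϖ₀ : Fin (2 + 1) → ℝ) D ≠ 0)
    (hQ : ∀ y ∈ KZ.cube 2, aeval (Fin.snoc y ϖ₀ : Fin (2 + 1) → ℝ) Qd ≠ 0)
    (hE : ∀ y ∈ KZ.cube 2,
      HasDerivAt (fun σ : ℝ =>
          aeval (Fin.snoc (![σ, y 1] : Fin 2 → ℝ) ϖ₀ : Fin (2 + 1) → ℝ) A /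
            aeval (Fin.snoc (![σ, y 1] : Fin 2 → ℝ) ϖ₀ : Fin (2 + 1) → ℝ) D)
        (aeval (Fin.snoc y ϖ₀ : Fin (2 + 1) → ℝ) Nn / aeval (Fin.snoc y ϖ₀ : Fin (2 + 1) → ℝ) Qd) (y 0))
    (hE01 : ∀ t ∈ Icc (0 : ℝ) 1,
      aeval (Fin.snoc (![1, t] : Fin 2 → ℝ) ϖ₀ : Fin (2 + 1) → ℝ) A /
          aeval (Fin.snoc (![1, t] : Fin 2 → ℝ) ϖ₀ : Fin (2 + 1) → ℝ) D =
        aeval (Fin.snoc (![0, t] : Fin 2 → ℝ) ϖ₀ : Fin (2 + 1) → ℝ) A /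
          aeval (Fin.snoc (![0, t] : Fin 2 → ℝ) ϖ₀ : Fin (2 + 1) → ℝ) D)
    (R : KZ.IntegralRep 2) (hR : R.IsTameCube)
    (hRi : ∀ y ∈ KZ.cube 2, R.integrand y =
      aeval (Fin.snoc y ϖ₀ : Fin (2 + 1) → ℝ) (X 1 ^ m * Nn) / aeval (Fin.snoc y ϖ₀ : Fin (2 + 1) → ℝ) Qd) :
    KZ.of R ∈ KZ.relations := by
  refine tame_relA_mem_relations (N := 1) 0
    (G := fun y : Fin 2 → ℝ => aeval (Fin.snoc y ϖ₀ : Fin (2 + 1) → ℝ) (X 1 ^ m * A) /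
      aeval (Fin.snoc y ϖ₀ : Fin (2 + 1) → ℝ) D)
    (G' := fun y : Fin 2 → ℝ => aeval (Fin.snoc y ϖ₀ : Fin (2 + 1) → ℝ) (X 1 ^ m * Nn) /
      aeval (Fin.snoc y ϖ₀ : Fin (2 + 1) → ℝ) Qd)
    (analyticOnNhd_slice _ _ ϖ₀ hD) (isSemialgebraicFunOn_slice _ _ halg hD)
    (analyticOnNhd_slice _ _ ϖ₀ hQ) (isSemialgebraicFunOn_slice _ _ halg hQ) ?_ R hR ?_
  · -- `∂_s (t^m · A/D) = t^m · ∂_s(A/D) = t^m · Nn/Qd` at every point of the square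
    rintro (w : Fin 2 → ℝ) hw
    have hfun : (fun s : ℝ =>
        aeval (Fin.snoc (Function.update w 0 s) ϖ₀ : Fin (2 + 1) → ℝ) (X 1 ^ m * A) /
          aeval (Fin.snoc (Function.update w 0 s) ϖ₀ : Fin (2 + 1) → ℝ) D) =
        fun σ => w 1 ^ m * (aeval (Fin.snoc (![σ, w 1] : Fin 2 → ℝ) ϖ₀ : Fin (2 + 1) → ℝ) A /
          aeval (Fin.snoc (![σ, w 1] : Fin 2 → ℝ) ϖ₀ : Fin (2 + 1) → ℝ) D) := by
      funext s
      rw [aeval_X_one_pow_mul_div, update_zero_eq_vec]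
      rfl
    rw [hfun]
    refine ((hE w hw).const_mul (w 1 ^ m)).congr_deriv ?_
    rw [aeval_X_one_pow_mul_div]
  · -- the two `s`-faces of `t^m · A/D` coincide, so `R`'s integrand is the full Ayoub element
    rintro (w : Fin 2 → ℝ) hw
    rw [hRi w hw, update_zero_eq_vec, update_zero_eq_vec, aeval_X_one_pow_mul_div m A D,
      aeval_X_one_pow_mul_div m A D, hE01 (w 1) (KZ.mem_cube.1 hw 1)]
    simp only [Matrix.cons_val_one]
    ring

end EulerBandExact

/-- STUB `stub_eulerBandExact` (wave 12 — (C) EXACT FACE BAND: one Ayoub element in `s`). If the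
weighted face family has a rational primitive in `s` along `ϖ = ϖ₀t^d` — polynomial data
`Em, Ed ∈ ℚ[s, ϖ]` with `Ed ≠ 0` on `[0,1] × {ϖ₀t^d : t ∈ [0,1]}`, `∂_s(Em/Ed)(s, ϖ₀t^d) =` the face
integrand without the weight, and equal endpoint values `(Em/Ed)(1,·) = (Em/Ed)(0,·)` — then the tame
cube `rb` of step (B) (integrand `t^{λ−1}·[aP₀(1,s)Q_b + bP₀(s,1)Q_a]/(Q_a Q_b)`, `λ = w + a + b`,
`Q_a = 1 − ϖ₀t^dT(1,s)`, `Q_b = 1 − ϖ₀t^dT(s,1)`) is a relation: `EulerBandExact.band_mem_relations`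
with the weight exponent `λ − 1`, `A/D = Em₃/Ed₃` and `Nn/Qd` the unweighted face band. (The
hypotheses `0 < d`, `1 ≤ λ` of the skeleton are not needed for this step.)
[cite: KontsevichZagier2001, §1.2] -/
theorem stub_eulerBandExact (a b d w : ℕ) (hd : 0 < d) (hl : 1 ≤ w + a + b) (T P₀ : MvPolynomial (Fin 2) ℚ)
    (ϖ₀ : ℝ) (halg : IsAlgebraic ℚ ϖ₀)
    (hadmA : ∀ y ∈ KZ.cube 2, aeval (Fin.snoc y ϖ₀ : Fin (2 + 1) → ℝ) (1 - X 2 * X 1 ^ d * bind₁ ![C 1, X 0] T) ≠ 0)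
    (hadmB : ∀ y ∈ KZ.cube 2, aeval (Fin.snoc y ϖ₀ : Fin (2 + 1) → ℝ) (1 - X 2 * X 1 ^ d * bind₁ ![X 0, C 1] T) ≠ 0)
    (rb : KZ.IntegralRep 2) (hrb : rb.IsTameCube)
    (hrbi : ∀ y ∈ KZ.cube 2, rb.integrand y =
      aeval (Fin.snoc y ϖ₀ : Fin (2 + 1) → ℝ)
          (X 1 ^ (w + a + b - 1) *
            (C (a : ℚ) * bind₁ ![C 1, X 0] P₀ * (1 - X 2 * X 1 ^ d * bind₁ ![X 0, C 1] T) +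
              C (b : ℚ) * bind₁ ![X 0, C 1] P₀ * (1 - X 2 * X 1 ^ d * bind₁ ![C 1, X 0] T))) /
        aeval (Fin.snoc y ϖ₀ : Fin (2 + 1) → ℝ)
          ((1 - X 2 * X 1 ^ d * bind₁ ![C 1, X 0] T) * (1 - X 2 * X 1 ^ d * bind₁ ![X 0, C 1] T)))
    (Em Ed : MvPolynomial (Fin (1 + 1)) ℚ)
    (hEd : ∀ y ∈ KZ.cube 2, aeval (Fin.snoc y ϖ₀ : Fin (2 + 1) → ℝ) (bind₁ ![X 0, X 2 * X 1 ^ d] Ed) ≠ 0)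
    (hE : ∀ y ∈ KZ.cube 2,
      HasDerivAt (fun σ : ℝ =>
          aeval (Fin.snoc (![σ, y 1] : Fin 2 → ℝ) ϖ₀ : Fin (2 + 1) → ℝ) (bind₁ ![X 0, X 2 * X 1 ^ d] Em) /
            aeval (Fin.snoc (![σ, y 1] : Fin 2 → ℝ) ϖ₀ : Fin (2 + 1) → ℝ) (bind₁ ![X 0, X 2 * X 1 ^ d] Ed))
        (aeval (Fin.snoc y ϖ₀ : Fin (2 + 1) → ℝ)
            (C (a : ℚ) * bind₁ ![C 1, X 0] P₀ * (1 - X 2 * X 1 ^ d * bind₁ ![X 0, C 1] T) +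
              C (b : ℚ) * bind₁ ![X 0, C 1] P₀ * (1 - X 2 * X 1 ^ d * bind₁ ![C 1, X 0] T)) /
          aeval (Fin.snoc y ϖ₀ : Fin (2 + 1) → ℝ)
            ((1 - X 2 * X 1 ^ d * bind₁ ![C 1, X 0] T) * (1 - X 2 * X 1 ^ d * bind₁ ![X 0, C 1] T)))
        (y 0))
    (hE01 : ∀ t ∈ Icc (0 : ℝ) 1,
      aeval (Fin.snoc (![1, t] : Fin 2 → ℝ) ϖ₀ : Fin (2 + 1) → ℝ) (bind₁ ![X 0, X 2 * X 1 ^ d] Em) /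
          aeval (Fin.snoc (![1, t] : Fin 2 → ℝ) ϖ₀ : Fin (2 + 1) → ℝ) (bind₁ ![X 0, X 2 * X 1 ^ d] Ed) =
        aeval (Fin.snoc (![0, t] : Fin 2 → ℝ) ϖ₀ : Fin (2 + 1) → ℝ) (bind₁ ![X 0, X 2 * X 1 ^ d] Em) /
          aeval (Fin.snoc (![0, t] : Fin 2 → ℝ) ϖ₀ : Fin (2 + 1) → ℝ) (bind₁ ![X 0, X 2 * X 1 ^ d] Ed)) :
    KZ.of rb ∈ KZ.relations := by
  have _ := hd
  have _ := hl
  -- the common denominator `Q_a · Q_b` of the face band does not vanish on the square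
  have hQ : ∀ y ∈ KZ.cube 2, aeval (Fin.snoc y ϖ₀ : Fin (2 + 1) → ℝ)
      ((1 - X 2 * X 1 ^ d * bind₁ ![C 1, X 0] T) * (1 - X 2 * X 1 ^ d * bind₁ ![X 0, C 1] T)) ≠ 0 :=
    fun y hy => by
      rw [map_mul]
      exact mul_ne_zero (hadmA y hy) (hadmB y hy)
  exact EulerBandExact.band_mem_relations (w + a + b - 1) halg _ _ _ _ hEd hQ hE hE01 rb hrb hrbi

end Summit.KontsevichZagierPeriods.InverseLandau.TateFamilyKernel.Descent

end
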